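import Mathlib.GroupTheory.GroupAction.ConjAct
import Summits.MatrixMultiplication.OmegaCensus.BoxUsefulThreeElements

/-!
# ω-census, family (b3): conjecture C9 (b) — normal exponent-`2` subgroups of a box-useful `{2,3}`-group meet the centre

HONEST FRAMING (pub-omega census; verbatim): lottery ticket; floor = certified bounds/negative ranges.
Census BOOKKEEPING (conjecture C9 of the cell, STRUCTURE.md §2; pub-omega kernel-l4 gen 16, task K-5, structure part; the
`p = 2` half of the centreless branch).

**Theorem (`TwoThree.exists_central_of_normal_exp_two`).** Let `G` be a finite box-useful group whose order has no prime
factor other than `2` and `3`, and `V ⊴ G` a non-trivial normal subgroup of exponent `≤ 2`.  Then `V ∩ Z(G) ≠ 1`.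
*Proof:* every element of `3`-power order centralises `V` (`ThreeElt.comm_of_exp_two`, i.e. the `A₄`-configuration
`KleinRot`); a Sylow `2`-subgroup `P` acting on `V` by conjugation fixes some `v ≠ 1` (class equation); the centraliser of `v`
contains `P` and every Sylow `3`-subgroup, so its index is prime to `2` and `3`, hence `1`.
**Corollary (`TwoThree.no_normal_exp_two_of_centerless`).** A CENTRELESS box-useful `{2,3}`-group has no non-trivial normal
subgroup of exponent `≤ 2`; in particular its minimal normal subgroups are `3`-groups.  Nothing here is progress on `ω`.
-/

namespace Summit.MatrixMultiplication.OmegaCensus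

open Finset ProductBoxBound

namespace TwoThree

variable {G : Type*} [Group G] [Fintype G] [DecidableEq G]

omit [DecidableEq G] in
/-- In a finite group whose order has only the prime factors `2` and `3`, a subgroup containing a Sylow `2`-subgroup and a
Sylow `3`-subgroup is everything. [folklore] -/
theorem eq_top_of_sylow_le (h23 : ∀ q : ℕ, q.Prime → q ∣ Fintype.card G → q = 2 ∨ q = 3) (F : Subgroup G)
    (P : Sylow 2 G) (T : Sylow 3 G) (hP : (P : Subgroup G) ≤ F) (hT : (T : Subgroup G) ≤ F) : F = ⊤ := by
  haveI : Fact (Nat.Prime 2) := ⟨Nat.prime_two⟩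
  haveI : Fact (Nat.Prime 3) := ⟨Nat.prime_three⟩
  rw [← Subgroup.index_eq_one]
  by_contra hne
  have h2 : ¬ 2 ∣ F.index := fun h => P.not_dvd_index (h.trans (Subgroup.index_dvd_of_le hP))
  have h3 : ¬ 3 ∣ F.index := fun h => T.not_dvd_index (h.trans (Subgroup.index_dvd_of_le hT))
  set q := (F.index).minFac with hq
  have hqp : q.Prime := Nat.minFac_prime hne
  have hqd : q ∣ F.index := Nat.minFac_dvd _
  have hqG : q ∣ Fintype.card G := by
    rw [← Nat.card_eq_fintype_card]; exact hqd.trans F.index_dvd_card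
  rcases h23 q hqp hqG with e | e
  · exact h2 (e ▸ hqd)
  · exact h3 (e ▸ hqd)

/-- **A non-trivial normal subgroup of exponent `≤ 2` of a box-useful `{2,3}`-group meets the centre.** [folklore] -/
theorem exists_central_of_normal_exp_two (hG : BoxUseful G)
    (h23 : ∀ q : ℕ, q.Prime → q ∣ Fintype.card G → q = 2 ∨ q = 3) (V : Subgroup G) [hVn : V.Normal]
    (hV2 : ∀ v ∈ V, v * v = 1) (hV : V ≠ ⊥) : ∃ v ∈ V, v ≠ 1 ∧ v ∈ Subgroup.center G := by
  classical
  haveI : Fact (Nat.Prime 2) := ⟨Nat.prime_two⟩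
  haveI : Fact (Nat.Prime 3) := ⟨Nat.prime_three⟩
  obtain ⟨P⟩ : Nonempty (Sylow 2 G) := inferInstance
  obtain ⟨T⟩ : Nonempty (Sylow 3 G) := inferInstance
  -- `2 ∣ |V|`
  have hdvd : 2 ∣ Nat.card V := by
    obtain ⟨v, hv, hv1⟩ : ∃ v ∈ V, v ≠ (1 : G) := by
      by_contra! hall
      exact hV ((Subgroup.eq_bot_iff_forall _).2 hall)
    have ho : orderOf (⟨v, hv⟩ : V) = 2 := by
      rw [Subgroup.orderOf_mk]
      exact orderOf_eq_prime (by rw [pow_two]; exact hV2 v hv) hv1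
    rw [← ho]; exact orderOf_dvd_natCard _
  -- the conjugation action of `P` on `V` (through `ConjAct G`) has a fixed point `b ≠ 1`
  let f : ConjAct (P : Subgroup G) →* ConjAct G :=
    (ConjAct.toConjAct (G := G)).toMonoidHom.comp ((P : Subgroup G).subtype.comp (ConjAct.ofConjAct.toMonoidHom))
  letI : MulAction (ConjAct (P : Subgroup G)) V := MulAction.compHom V f
  have hsmul : ∀ (x : ConjAct (P : Subgroup G)) (w : V),
      ((x • w : V) : G) = ((ConjAct.ofConjAct x : (P : Subgroup G)) : G) * w *
        ((ConjAct.ofConjAct x : (P : Subgroup G)) : G)⁻¹ := by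
    intro x w
    change (((f x) • w : V) : G) = _
    rw [ConjAct.Subgroup.val_conj_smul]
    rfl
  have hPp : IsPGroup 2 (ConjAct (P : Subgroup G)) := P.isPGroup'.of_equiv ConjAct.toConjAct
  have h1 : (1 : V) ∈ MulAction.fixedPoints (ConjAct (P : Subgroup G)) V := fun x => by
    apply Subtype.ext; rw [hsmul]; simp
  obtain ⟨b, hb, hb1⟩ := hPp.exists_fixed_point_of_prime_dvd_card_of_fixed_point V hdvd h1
  -- the centraliser of `b` contains `P` and every `3`-element
  set F : Subgroup G := Subgroup.centralizer {(b : G)} with hF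
  have hPF : (P : Subgroup G) ≤ F := by
    intro p hp
    rw [hF, Subgroup.mem_centralizer_iff]
    intro y hy
    rw [Set.mem_singleton_iff] at hy; subst hy
    have := congrArg Subtype.val (hb (ConjAct.toConjAct (⟨p, hp⟩ : (P : Subgroup G))))
    rw [hsmul, ConjAct.ofConjAct_toConjAct] at this
    -- `this : p * b * p⁻¹ = b`
    exact (mul_inv_eq_iff_eq_mul.1 this).symm
  have hTF : (T : Subgroup G) ≤ F := by
    intro t ht
    rw [hF, Subgroup.mem_centralizer_iff]
    intro y hy
    rw [Set.mem_singleton_iff] at hy; subst hy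
    obtain ⟨k, hk⟩ := IsPGroup.iff_orderOf.mp T.isPGroup' ⟨t, ht⟩
    rw [Subgroup.orderOf_mk] at hk
    have hcen := ThreeElt.comm_of_exp_two hG V hV2 t (k := k) (fun v _ => by rw [← hk, pow_orderOf_eq_one, one_mul, mul_one])
    exact (hcen b b.2).symm
  have hFtop : F = ⊤ := eq_top_of_sylow_le h23 F P T hPF hTF
  refine ⟨b, b.2, fun h => hb1 (Subtype.ext h).symm, ?_⟩
  rw [Subgroup.mem_center_iff]
  intro g
  have hg : g ∈ F := by rw [hFtop]; exact Subgroup.mem_top g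
  rw [hF, Subgroup.mem_centralizer_iff] at hg
  exact (hg b (Set.mem_singleton _)).symm

/-- **A centreless box-useful `{2,3}`-group has no non-trivial normal subgroup of exponent `≤ 2`.** [folklore] -/
theorem no_normal_exp_two_of_centerless (hG : BoxUseful G)
    (h23 : ∀ q : ℕ, q.Prime → q ∣ Fintype.card G → q = 2 ∨ q = 3) (hZ : Subgroup.center G = ⊥) (V : Subgroup G)
    [V.Normal] (hV2 : ∀ v ∈ V, v * v = 1) : V = ⊥ := by
  by_contra hV
  obtain ⟨v, -, hv1, hvZ⟩ := exists_central_of_normal_exp_two hG h23 V hV2 hV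
  rw [hZ, Subgroup.mem_bot] at hvZ
  exact hv1 hvZ

end TwoThree

end Summit.MatrixMultiplication.OmegaCensus
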